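import Summits.QuantumFields.YangMills.Theorems.SourcedPressureJensenSourcedPressureIncrementGaussSourceMoments
import Summits.QuantumFields.YangMills.Theorems.SourcedPressureJensenSourcedPressureIncrementUniformStability
import Summits.QuantumFields.YangMills.Theorems.SourcedPressureJensenSourcedPressureIncrementCgfWindowMoments
import HarnessLib

/-!
# `SourcedPressureIncrement` (stmt-QuantumFields-22517), line `birth`: the GAUSSIAN SOURCED INCREMENT IN THE WINDOW `h·|B| ≤ h₀`
# — `log E_γ e^{−hH_B} ≤ −h·E_γH_B + M·h²·|B|²` to ALL orders in `h`, with no cluster expansion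

Helper toward the deciding crux stmt-QuantumFields-22517 (`SourcedPressureJensen.SourcedPressureIncrement`; free-cell children
KS1′ stmt-QuantumFields-23996 / KS2′ stmt-QuantumFields-24028).  The ideator's BC3 stub `stub_gauss` asks for
`gaussIncrement D λ h n L ≤ −h(λ²D/2)C(n)² + M h² + C n/L` for `0 < h ≤ h₀` with `M, h₀` uniform in the box: its first cumulant is
exact (`GaussFirstCumulant`), its second is extensive (`GaussSecondCumulant`), but the orders `≥ 3` at FIXED `h₀` need decay of
correlations under the tilted (non-Gaussian) measure — a massless cluster expansion.  In the WINDOWED currency proposed by the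
line's lead (STATUS 2026-08-28T00:17Z: «`h⁻¹·increment ≤ −σC(n)² + Cβ^{−κ}` for `0 < h ≤ h₀β^{−p}`»; in the composition only
`h = β^{−κ/2}` against a box of `≍ β^{8θ}` sites is ever used) the Gaussian side closes with crude tools, and this file does it:

* (file 1/2 `…GaussSourceMoments`) uniform moment bounds `E_γ[A_p⁸] ≤ K₈(D,λ)`, `E_γ[(Σ_{x∈B}(X_x − m))⁴] ≤ |B|⁴·8(K₈ + m⁴)`;
* **`gauss_increment_window_sq_card`** — there are `M ≥ 0`, `h₀ > 0` (depending on `D, λ` only) such that for every separation `n`,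
  finite `B ⊂ ℤ⁴` and `0 < h` with `h·|B| ≤ h₀`:
  `log E_γ exp(−h Σ_{x∈B} A_xA_{x+ne₀}) ≤ −h·|B|·(λ²D/2)·C(n)² + M·h²·|B|²`
  (source of `gaussIncrement` VERBATIM; per site `gaussIncrement ≤ −hσC(n)² + M h²|B|`).  Assembly: the one-sided moment bound
  `log_integral_exp_neg_mul_le_of_moments` (`…CgfWindowMoments`: only NEGATIVE exponential moments — `H_B` has no positive ones),
  `∫Z² ≤ M₂|B|` (`gauss_secondCumulant_le`), `∫Z⁴ ≤ K₄|B|⁴` (above), and `∫e^{−2hZ} ≤ E₀` in the window from the volume-uniform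
  ceiling `gauss_increment_jensen_uniform` of `…UniformStability` (`log E_γ e^{−2hH_B} ≤ hλ²D²|B|`, `h ≤ 1/(2(λ²D+4))`).

Relation to the sibling file `…GaussWindowBound` (w3, `gauss_increment_window`: remainder `K·h²·(|B|+1)⁴` from exponential moments
alone): here the second cumulant enters through `Var_γ H_B ≤ M₂|B|` and the remainder is `M·h²·|B|²`; the hypercontractive fourth
moment would give `M·h²·|B|`.  RECORD-label rung support (all-`G` leaf `WeakCouplingRates.XiPow`); the Yang–Mills mass gap is NOT
proved by anything here.  Sources: S. Janson, *Gaussian Hilbert Spaces* (1997) Thm 1.28 / Rem. 1.30. [folklore]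
-/

noncomputable section

open MeasureTheory ProbabilityTheory Real
open scoped Nat
open Literature.Probability.Distributions
open Literature.MathematicalPhysics.QuantumFieldTheory Literature.MathematicalPhysics.QuantumLattice
open Literature.Probability.LatticeModels Literature.Barriers.CriticalPhenomena

namespace Summit.QuantumFields.YangMills.Cruxes.SourcedPressureIncrement.Birth

/-! ### §3 The window theorem -/
set_option maxHeartbeats 400000 in
/-- **THE GAUSSIAN SOURCED INCREMENT IN THE WINDOW `h·|B| ≤ h₀`, ALL ORDERS IN `h`, remainder `M·h²·|B|²`.**  For every colour number `D` and scale
`λ ≥ 0` there are `M ≥ 0` and `h₀ > 0` such that for every separation `n`, every finite `B ⊂ ℤ⁴` and every `h > 0` with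
`h·|B| ≤ h₀`:
`log E_γ exp(−h Σ_{x∈B} A_xA_{x+ne₀}) ≤ −h·|B|·(λ²D/2)·C(n)² + M·h²·|B|²`
(the source of `gaussIncrement` VERBATIM; per site: `gaussIncrement ≤ −hσC(n)² + M·h²·|B|` in the window).  Assembly of:
the one-sided moment bound `log_integral_exp_neg_mul_le_of_moments` (file `…CgfWindowMoments`), the extensive second cumulant
`gauss_secondCumulant_le` (`∫Z² ≤ M₂|B|`), the crude uniform fourth moment `integral_centredSource_pow_four_le`
(`∫Z⁴ ≤ K₄|B|⁴`), and the volume-uniform ceiling `gauss_increment_jensen_uniform` of `…UniformStability`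
(`log E_γe^{−2hH_B} ≤ hλ²D²|B|`, whence `∫e^{−2hZ} ≤ E₀` in the window).  No cluster expansion and no tilted measure: this is the
Gaussian model case of KS in the WINDOWED currency `0 < h ≤ h₀·|box|⁻¹`. [folklore] -/
theorem gauss_increment_window_sq_card (D : ℕ) {lam : ℝ} (hlam : 0 ≤ lam) :
    ∃ M h₀ : ℝ, 0 ≤ M ∧ 0 < h₀ ∧ ∀ (n : ℕ) (B : Finset (Site 4)) (h : ℝ), 0 < h → h * B.card ≤ h₀ →
      Real.log (∫ Y, Real.exp (-h * ∑ x ∈ B,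
          (lam / 2 * (∑ a : Fin D, (Y (plaquette12 (d := 4) (by norm_num) x) a) ^ 2) -
              lam / 2 * D * curvaturePlaquetteCorr (d := 4) (by norm_num) 0) *
            (lam / 2 * (∑ a : Fin D, (Y (plaquette12 (d := 4) (by norm_num) (x + Pi.single (0 : Fin 4) (n : ℤ))) a) ^ 2) -
              lam / 2 * D * curvaturePlaquetteCorr (d := 4) (by norm_num) 0))
          ∂curvatureGaussianField (d := 4) D) ≤
        -h * ((B.card : ℝ) * (lam ^ 2 * D / 2 * (curvaturePlaquetteCorr (d := 4) (by norm_num) (n : ℤ)) ^ 2)) +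
          M * h ^ 2 * (B.card : ℝ) ^ 2 := by
  have hd : 3 ≤ 4 := by norm_num
  obtain ⟨M₂, hM₂0, hM₂⟩ := gauss_secondCumulant_le D lam
  obtain ⟨K, hK0, hK⟩ := exists_abs_curvatureTwoPoint_plaquette12_le
  set C0 : ℝ := curvaturePlaquetteCorr (d := 4) hd 0 with hC0
  -- the constants (kept opaque: only their defining equations are used)
  obtain ⟨σ, hσ⟩ : ∃ σ : ℝ, σ = lam ^ 2 * D / 2 := ⟨_, rfl⟩
  have hσ0 : 0 ≤ σ := by rw [hσ]; positivity
  obtain ⟨K8, hK8⟩ : ∃ K8 : ℝ,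
      K8 = 128 * ((lam / 2) ^ 8 * ((D : ℝ) ^ 7 * (D * (((15‼ : ℕ) : ℝ) * (1 / 2) ^ 8))) + (lam / 2 * D * C0) ^ 8) :=
    ⟨_, rfl⟩
  have hK80 : 0 ≤ K8 := by rw [hK8]; positivity
  obtain ⟨K4, hK4⟩ : ∃ K4 : ℝ, K4 = 8 * (K8 + (σ * K ^ 2) ^ 4) := ⟨_, rfl⟩
  have hK40 : 0 ≤ K4 := by rw [hK4]; exact mul_nonneg (by norm_num) (add_nonneg hK80 (by positivity))
  have hden : 0 < lam ^ 2 * D + 4 := by positivity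
  obtain ⟨h₀, hh₀⟩ : ∃ h₀ : ℝ, h₀ = 1 / (2 * (lam ^ 2 * D + 4)) := ⟨_, rfl⟩
  have hh₀0 : 0 < h₀ := by rw [hh₀]; positivity
  obtain ⟨E₀, hE₀⟩ : ∃ E₀ : ℝ, E₀ = Real.exp (2 * h₀ * (σ * K ^ 2) + h₀ * (lam ^ 2 * D ^ 2)) := ⟨_, rfl⟩
  have hE₀0 : 0 < E₀ := by rw [hE₀]; exact Real.exp_pos _
  obtain ⟨M, hM⟩ : ∃ M : ℝ, M = (M₂ + K4 ^ (1 / 2 : ℝ) * E₀ ^ (1 / 2 : ℝ)) / 2 := ⟨_, rfl⟩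
  have hM0 : 0 ≤ M := by
    rw [hM]
    exact div_nonneg (add_nonneg hM₂0 (mul_nonneg (Real.rpow_nonneg hK40 _) (Real.rpow_nonneg hE₀0.le _)))
      zero_le_two
  refine ⟨M, h₀, hM0, hh₀0, fun n B h hh hwin => ?_⟩
  set γ := curvatureGaussianField (d := 4) D with hγ
  haveI := isProbabilityMeasure_curvatureGaussianField hd D
  -- the empty box
  rcases B.eq_empty_or_nonempty with hB | hB
  · subst hB
    simp
  have hcard : (1 : ℝ) ≤ B.card := by exact_mod_cast Finset.card_pos.2 hB
  have hcard0 : (0 : ℝ) ≤ B.card := by positivity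
  have hhB : h ≤ h * B.card := le_mul_of_one_le_right hh.le hcard
  have hh1 : h ≤ h₀ := hhB.trans hwin
  have hle1 : h ≤ 1 / (lam ^ 2 * D + 4) := by
    refine hh1.trans ?_
    rw [hh₀]
    exact one_div_le_one_div_of_le hden (by linarith)
  have hle2 : 2 * h ≤ 1 / (lam ^ 2 * D + 4) := by
    have : 2 * h ≤ 2 * h₀ := by linarith
    refine this.trans (le_of_eq ?_)
    rw [hh₀]; field_simp
  -- the source, its mean, the centred source
  set v : Site 4 := Pi.single (0 : Fin 4) (n : ℤ) with hv
  set Cn : ℝ := curvaturePlaquetteCorr (d := 4) hd (n : ℤ) with hCn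
  set m : ℝ := σ * Cn ^ 2 with hm
  set H : (ZdPlaquette 4 → Fin D → ℝ) → ℝ := fun Y => ∑ x ∈ B,
      (lam / 2 * (∑ a : Fin D, (Y (plaquette12 (d := 4) hd x) a) ^ 2) - lam / 2 * D * C0) *
        (lam / 2 * (∑ a : Fin D, (Y (plaquette12 (d := 4) hd (x + v)) a) ^ 2) - lam / 2 * D * C0) with hH
  set mB : ℝ := (B.card : ℝ) * (lam ^ 2 * D / 2 * Cn ^ 2) with hmB
  have hmBm : mB = B.card * m := by rw [hmB, hm, hσ]
  -- |C(n)| ≤ K, hence 0 ≤ m ≤ σ K²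
  have hCnK : |Cn| ≤ K := by
    have h1 := hK 0 (0 + v)
    have h2 : (1 + euclidNorm ((0 : Site 4) - (0 + v))) ^ (-(4 : ℝ)) ≤ 1 :=
      Real.rpow_le_one_of_one_le_of_nonpos (by linarith [euclidNorm_nonneg ((0 : Site 4) - (0 + v))]) (by norm_num)
    have h0f : (⟨0, by omega⟩ : Fin 4) = 0 := rfl
    have h3 : curvatureTwoPoint (plaquette12 (d := 4) hd 0) (plaquette12 (d := 4) hd (0 + v)) = Cn := by
      have h := curvatureTwoPoint_plaquette12_shift hd (0 : Site 4) (n : ℤ)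
      rw [h0f] at h
      exact h
    rw [← h3]
    exact h1.trans (mul_le_of_le_one_right hK0 h2)
  have hm0 : 0 ≤ m := by positivity
  have hmK : m ≤ σ * K ^ 2 := by
    rw [hm]
    refine mul_le_mul_of_nonneg_left ?_ hσ0
    calc Cn ^ 2 = |Cn| ^ 2 := (sq_abs _).symm
      _ ≤ K ^ 2 := pow_le_pow_left₀ (abs_nonneg _) hCnK 2
  have hmB0 : 0 ≤ mB := by rw [hmBm]; exact mul_nonneg hcard0 hm0
  -- (i) mean and integrability of the source
  have hmean : ∫ Y, H Y ∂γ = mB := by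
    have hfc := gauss_firstCumulant_sum D lam n B
    exact hfc
  have hH1 : Integrable H γ := by
    have hint := integrable_finsetSum B fun x _ => integrable_gauss_summand D lam n x
    exact hint
  -- (ii) the centred source `Z = H − mB` and its moments
  have hZ0 : ∫ Y, (H Y - mB) ∂γ = 0 := by
    rw [integral_sub hH1 (integrable_const _), hmean, integral_const, probReal_univ, one_smul, sub_self]
  have hZ1 : Integrable (fun Y => H Y - mB) γ := hH1.sub (integrable_const _)
  obtain ⟨iZ4', hZ4'⟩ := integral_centredSource_pow_four_le D lam m n B
  have eZ : ∀ Y : ZdPlaquette 4 → Fin D → ℝ,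
      (∑ x ∈ B, ((lam / 2 * (∑ a : Fin D, (Y (plaquette12 (d := 4) hd x) a) ^ 2) - lam / 2 * D * C0) *
          (lam / 2 * (∑ a : Fin D, (Y (plaquette12 (d := 4) hd (x + v)) a) ^ 2) - lam / 2 * D * C0) - m)) =
        H Y - mB := by
    intro Y
    rw [Finset.sum_sub_distrib, Finset.sum_const, nsmul_eq_mul, hmBm]
  have hZ4 : Integrable (fun Y => (H Y - mB) ^ 4) γ :=
    iZ4'.congr (ae_of_all _ fun Y => congrArg (fun t : ℝ => t ^ 4) (eZ Y))
  have hZ4le : ∫ Y, (H Y - mB) ^ 4 ∂γ ≤ (B.card : ℝ) ^ 4 * K4 := by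
    have e1 : ∫ Y, (H Y - mB) ^ 4 ∂γ = ∫ Y, (∑ x ∈ B,
        ((lam / 2 * (∑ a : Fin D, (Y (plaquette12 (d := 4) hd x) a) ^ 2) - lam / 2 * D * C0) *
          (lam / 2 * (∑ a : Fin D, (Y (plaquette12 (d := 4) hd (x + v)) a) ^ 2) - lam / 2 * D * C0) - m)) ^ 4 ∂γ :=
      integral_congr_ae (ae_of_all _ fun Y => congrArg (fun t : ℝ => t ^ 4) (eZ Y).symm)
    rw [e1]
    refine hZ4'.trans (mul_le_mul_of_nonneg_left ?_ (by positivity))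
    rw [hK4]
    have : m ^ 4 ≤ (σ * K ^ 2) ^ 4 := pow_le_pow_left₀ hm0 hmK 4
    exact mul_le_mul_of_nonneg_left (add_le_add (le_of_eq hK8.symm) this) (by norm_num)
  have hZ2 : Integrable (fun Y => (H Y - mB) ^ 2) γ := by
    refine ((integrable_const (1 : ℝ)).add hZ4).mono' ((hZ1.aestronglyMeasurable.pow 2)) (ae_of_all _ fun Y => ?_)
    rw [Real.norm_eq_abs, abs_of_nonneg (sq_nonneg _)]
    show (H Y - mB) ^ 2 ≤ 1 + (H Y - mB) ^ 4
    have hsq0 := sq_nonneg ((H Y - mB) ^ 2 - 1 / 2)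
    have hid : 1 + (H Y - mB) ^ 4 - (H Y - mB) ^ 2 = ((H Y - mB) ^ 2 - 1 / 2) ^ 2 + 3 / 4 := by ring
    linarith only [hid, hsq0]
  have hZ2le : ∫ Y, (H Y - mB) ^ 2 ∂γ ≤ M₂ * B.card := by
    have h2 := hM₂ n B
    exact h2
  -- (iii) negative exponential moments, from the volume-uniform stability of `…UniformStability`
  obtain ⟨iE1', -, -⟩ := gauss_increment_jensen_uniform D hlam n B hh.le hle1
  obtain ⟨iE2', -, hceil2⟩ := gauss_increment_jensen_uniform D hlam n B (by positivity : (0 : ℝ) ≤ 2 * h) hle2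
  have eE : ∀ (t : ℝ) (Y : ZdPlaquette 4 → Fin D → ℝ),
      Real.exp (-(t * (H Y - mB))) = Real.exp (t * mB) * Real.exp (-t * H Y) := by
    intro t Y; rw [← Real.exp_add]; ring_nf
  have hE1 : Integrable (fun Y => Real.exp (-(h * (H Y - mB)))) γ := by
    have := iE1'.const_mul (Real.exp (h * mB))
    exact this.congr (ae_of_all _ fun Y => (eE h Y).symm)
  have hE2 : Integrable (fun Y => Real.exp (-(2 * h * (H Y - mB)))) γ := by
    have := iE2'.const_mul (Real.exp (2 * h * mB))
    exact this.congr (ae_of_all _ fun Y => (eE (2 * h) Y).symm)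
  have hE2le : ∫ Y, Real.exp (-(2 * h * (H Y - mB))) ∂γ ≤ E₀ := by
    have e1 : ∫ Y, Real.exp (-(2 * h * (H Y - mB))) ∂γ = Real.exp (2 * h * mB) * ∫ Y, Real.exp (-(2 * h) * H Y) ∂γ := by
      rw [← integral_const_mul]
      exact integral_congr_ae (ae_of_all _ fun Y => eE (2 * h) Y)
    have hpos : 0 < ∫ Y, Real.exp (-(2 * h) * H Y) ∂γ := integral_exp_pos iE2'
    have h2 : ∫ Y, Real.exp (-(2 * h) * H Y) ∂γ ≤ Real.exp (2 * h * (lam ^ 2 * D ^ 2 / 2) * B.card) := by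
      rw [← Real.log_le_iff_le_exp hpos]; exact hceil2
    have h3 : 2 * h * mB ≤ 2 * h₀ * (σ * K ^ 2) := by
      rw [hmBm]
      calc 2 * h * (B.card * m) = 2 * (h * B.card) * m := by ring
        _ ≤ 2 * h₀ * (σ * K ^ 2) :=
          mul_le_mul (mul_le_mul_of_nonneg_left hwin zero_le_two) hmK hm0 (mul_nonneg zero_le_two hh₀0.le)
    have h4 : 2 * h * (lam ^ 2 * D ^ 2 / 2) * B.card ≤ h₀ * (lam ^ 2 * D ^ 2) := by
      calc 2 * h * (lam ^ 2 * D ^ 2 / 2) * B.card = (h * B.card) * (lam ^ 2 * D ^ 2) := by ring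
        _ ≤ h₀ * (lam ^ 2 * D ^ 2) := mul_le_mul_of_nonneg_right hwin (by positivity)
    rw [e1, hE₀]
    calc Real.exp (2 * h * mB) * ∫ Y, Real.exp (-(2 * h) * H Y) ∂γ
        ≤ Real.exp (2 * h₀ * (σ * K ^ 2)) * Real.exp (h₀ * (lam ^ 2 * D ^ 2)) :=
          mul_le_mul (Real.exp_le_exp.2 h3) (h2.trans (Real.exp_le_exp.2 h4)) hpos.le (Real.exp_pos _).le
      _ = Real.exp (2 * h₀ * (σ * K ^ 2) + h₀ * (lam ^ 2 * D ^ 2)) := by rw [Real.exp_add]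
  -- (iv) the one-sided moment bound
  have key := log_integral_exp_neg_mul_le_of_moments (μ := γ) (Z := fun Y => H Y - mB) (h := h) hZ0 hZ1 hZ2 hZ4 hE1 hE2
  -- (v) assemble
  have hconv : ∫ Y, Real.exp (-(h * (H Y - mB))) ∂γ = Real.exp (h * mB) * ∫ Y, Real.exp (-h * H Y) ∂γ := by
    rw [← integral_const_mul]
    exact integral_congr_ae (ae_of_all _ fun Y => eE h Y)
  have hpos1 : 0 < ∫ Y, Real.exp (-h * H Y) ∂γ := integral_exp_pos iE1'
  have hlog : Real.log (∫ Y, Real.exp (-(h * (H Y - mB))) ∂γ) = h * mB + Real.log (∫ Y, Real.exp (-h * H Y) ∂γ) := by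
    rw [hconv, Real.log_mul (Real.exp_pos _).ne' hpos1.ne', Real.log_exp]
  have hroot4 : (∫ Y, (H Y - mB) ^ 4 ∂γ) ^ (1 / 2 : ℝ) ≤ K4 ^ (1 / 2 : ℝ) * (B.card : ℝ) ^ 2 := by
    have h1 : (∫ Y, (H Y - mB) ^ 4 ∂γ) ^ (1 / 2 : ℝ) ≤ ((B.card : ℝ) ^ 4 * K4) ^ (1 / 2 : ℝ) :=
      Real.rpow_le_rpow (integral_nonneg fun Y => by positivity) hZ4le (by norm_num)
    refine h1.trans (le_of_eq ?_)
    have e4 : ((B.card : ℝ) ^ 4) ^ (1 / 2 : ℝ) = (B.card : ℝ) ^ 2 := by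
      rw [show (B.card : ℝ) ^ 4 = ((B.card : ℝ) ^ 2) ^ 2 by ring, ← Real.sqrt_eq_rpow, Real.sqrt_sq (by positivity)]
    rw [Real.mul_rpow (by positivity) hK40, e4, mul_comm]
  have hrootE : (∫ Y, Real.exp (-(2 * h * (H Y - mB))) ∂γ) ^ (1 / 2 : ℝ) ≤ E₀ ^ (1 / 2 : ℝ) :=
    Real.rpow_le_rpow (integral_nonneg fun Y => (Real.exp_pos _).le) hE2le (by norm_num)
  have hsq : (B.card : ℝ) ≤ (B.card : ℝ) ^ 2 := le_self_pow₀ hcard two_ne_zero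
  have hprod : (∫ Y, (H Y - mB) ^ 4 ∂γ) ^ (1 / 2 : ℝ) * (∫ Y, Real.exp (-(2 * h * (H Y - mB))) ∂γ) ^ (1 / 2 : ℝ) ≤
      K4 ^ (1 / 2 : ℝ) * E₀ ^ (1 / 2 : ℝ) * (B.card : ℝ) ^ 2 := by
    calc _ ≤ (K4 ^ (1 / 2 : ℝ) * (B.card : ℝ) ^ 2) * E₀ ^ (1 / 2 : ℝ) :=
          mul_le_mul hroot4 hrootE (Real.rpow_nonneg (integral_nonneg fun Y => (Real.exp_pos _).le) _)
            (mul_nonneg (Real.rpow_nonneg hK40 _) (pow_nonneg hcard0 2))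
      _ = K4 ^ (1 / 2 : ℝ) * E₀ ^ (1 / 2 : ℝ) * (B.card : ℝ) ^ 2 := by ring
  have hfinal : h ^ 2 / 2 * (∫ Y, (H Y - mB) ^ 2 ∂γ +
      (∫ Y, (H Y - mB) ^ 4 ∂γ) ^ (1 / 2 : ℝ) * (∫ Y, Real.exp (-(2 * h * (H Y - mB))) ∂γ) ^ (1 / 2 : ℝ)) ≤
      M * h ^ 2 * (B.card : ℝ) ^ 2 := by
    have h1 : ∫ Y, (H Y - mB) ^ 2 ∂γ ≤ M₂ * (B.card : ℝ) ^ 2 := hZ2le.trans (mul_le_mul_of_nonneg_left hsq hM₂0)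
    have hh2 : 0 ≤ h ^ 2 / 2 := by positivity
    calc _ ≤ h ^ 2 / 2 * (M₂ * (B.card : ℝ) ^ 2 + K4 ^ (1 / 2 : ℝ) * E₀ ^ (1 / 2 : ℝ) * (B.card : ℝ) ^ 2) :=
          mul_le_mul_of_nonneg_left (add_le_add h1 hprod) hh2
      _ = M * h ^ 2 * (B.card : ℝ) ^ 2 := by rw [hM]; ring
  have hmain := key.trans hfinal
  rw [hlog] at hmain
  show Real.log (∫ Y, Real.exp (-h * H Y) ∂γ) ≤ -h * mB + M * h ^ 2 * (B.card : ℝ) ^ 2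
  linarith only [hmain]

end Summit.QuantumFields.YangMills.Cruxes.SourcedPressureIncrement.Birth
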